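import Literature.Probability.LatticeModels.TreeGraphWickPairing
import Literature.Probability.LatticeModels.GaussianPairingBoundCouplings
import Literature.Probability.LatticeModels.WeightedTreeBoundCorrelations
import HarnessLib

/-!
# Deviation from Wick's law, tree-diagram form — IV: pair-interaction Gibbs states, coincident points

Topic `Literature/Probability/LatticeModels`. The headline of the series
`TreeGraphWickCurrents` / `TreeGraphWickBound` / `TreeGraphWickPairing`:

  `PairIsing.abs_avg_spinMonomial_sub_pairingSum_le` — for a finite set `ι`, couplings `c ≥ 0`
  (weight `exp(∑_{a,b} c_{ab}σ_aσ_b)`), every `n` and EVERY `x : Fin (2n) → ι`,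
  `|⟨σ_{x₁}⋯σ_{x_{2n}}⟩_c - 𝒢_n[⟨σσ⟩_c](x)| ≤ 2 · wickRemainder ⟨σσ⟩_c T n x`,
  `T(u) = ∑_v ∏_j ⟨σ_{u_j}σ_v⟩_c`

— the tree-diagram form of Aizenman's bound on the deviation from Wick's law (Aizenman 1982, Prop. 12.1
with the tree diagram bound Prop. 5.3; Panis 2023, Prop. 4.6 with §4.2), constant `2`, PROVED. Distinct
points come from `Current.abs_ratio_image_sub_pairingSum_le` through the dictionary
`⟨σ_A⟩_c = Z_K[A]/Z_K[∅]`, `K = pairEdgeWeight c 2` (`avg_spinProduct_eq_ratio`). Coincident points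
(Aizenman, p. 37: "easily reduced") by PENDANT spins: on `ι ⊕ Fin (2n)` couple the auxiliary spin `i` to the
site `x i` with strength `ε/2` (`pend`); summing out the auxiliary spins gives
`⟨(∏_{i∈I} η_i) F(σ)⟩ = tanh(ε)^{|I|} ⟨(∏_{i∈I} σ_{x_i}) F⟩_c` (`avg_pend_prod_mul`), so the distinct-point
bound for the `2n` auxiliary spins is `tanh(ε)^{2n}` times the claim up to an error `O(tanh(ε)^2)` from the
auxiliary vertices in the tree diagram (`pend_tree_le`), and `ε → 0`.

## References

* M. Aizenman, Comm. Math. Phys. 86 (1982), Prop. 5.3, Prop. 12.1 and p. 37 [AizenmanCMP1982].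
* R. Panis, arXiv:2309.05797 (2023), Prop. 4.6, §4.1–4.2 [Panis2023Triviality].
* D. Brydges, J. Fröhlich, A. Sokal, Comm. Math. Phys. 91 (1983) 117–139, §4 [BrydgesFrohlichSokal1983].
-/

noncomputable section

open Finset Filter Topology
open scoped symmDiff

namespace Literature.Probability.LatticeModels

namespace PairIsing

variable {ι : Type*} [Fintype ι] [DecidableEq ι]

/-! ### Pendant couplings: one auxiliary spin per point, coupled only to that point -/

/-- The pendant extension of a coupling matrix: on `ι ⊕ Fin m`, the old couplings between the sites of `ι`,
a coupling `ε/2` (in each order) between the auxiliary spin `i` and the site `x i`, nothing else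
(Aizenman 1982, p. 37: "the cases with coincidental points are easily reduced" — here by attaching to each
point an auxiliary spin, so that the `2n` auxiliary spins are distinct vertices). [cite: AizenmanCMP1982, §12, proof of Prop. 12.1 (reduction of coincident points, p. 37)] -/
def pend (c : ι → ι → ℝ) {m : ℕ} (x : Fin m → ι) (ε : ℝ) : ι ⊕ Fin m → ι ⊕ Fin m → ℝ := fun a b =>
  match a, b with
  | .inl a, .inl b => c a b
  | .inl a, .inr i => if x i = a then ε / 2 else 0
  | .inr i, .inl a => if x i = a then ε / 2 else 0
  | .inr _, .inr _ => 0

variable (c : ι → ι → ℝ) {m : ℕ} (x : Fin m → ι) (ε : ℝ)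

omit [Fintype ι] in
/-- Pendant couplings are nonnegative for `c ≥ 0`, `ε ≥ 0`. [folklore] -/
theorem pend_nonneg (hc : ∀ a b, 0 ≤ c a b) (hε : 0 ≤ ε) : ∀ a b, 0 ≤ pend c x ε a b := by
  rintro (a | i) (b | j)
  · exact hc a b
  · simp only [pend]; split_ifs <;> positivity
  · simp only [pend]; split_ifs <;> positivity
  · simp only [pend]; exact le_rfl

/-- The pendant energy: `∑_{a',b'} c'_{a'b'} σ'_{a'}σ'_{b'} = ∑_{a,b} c_{ab} σ_aσ_b + ε ∑_i η_i σ_{x_i}`. [folklore] -/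
theorem sum_sum_pend (σ' : SpinConfig (ι ⊕ Fin m)) :
    ∑ a, ∑ b, pend c x ε a b * (spinAt a σ' * spinAt b σ') =
      ∑ a, ∑ b, c a b * (spinAt a (σ' ∘ Sum.inl) * spinAt b (σ' ∘ Sum.inl)) +
        ε * ∑ i, spinAt (Sum.inr i) σ' * spinAt (Sum.inl (x i)) σ' := by
  simp only [Fintype.sum_sum_type, pend, zero_mul, Finset.sum_const_zero, add_zero, ite_mul]
  rw [Finset.sum_add_distrib]
  have h1 : ∑ a : ι, ∑ i : Fin m, (if x i = a then ε / 2 * (spinAt (Sum.inl a) σ' * spinAt (Sum.inr i) σ') else 0) =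
      ∑ i : Fin m, ε / 2 * (spinAt (Sum.inl (x i)) σ' * spinAt (Sum.inr i) σ') := by
    rw [Finset.sum_comm]
    refine Finset.sum_congr rfl fun i _ => ?_
    rw [Finset.sum_ite_eq univ (x i)]
    simp
  have h2 : ∑ i : Fin m, ∑ a : ι, (if x i = a then ε / 2 * (spinAt (Sum.inr i) σ' * spinAt (Sum.inl a) σ') else 0) =
      ∑ i : Fin m, ε / 2 * (spinAt (Sum.inr i) σ' * spinAt (Sum.inl (x i)) σ') := by
    refine Finset.sum_congr rfl fun i _ => ?_
    rw [Finset.sum_ite_eq univ (x i)]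
    simp
  rw [h1, h2, add_assoc, ← Finset.sum_add_distrib, Finset.mul_sum]
  congr 1
  refine Finset.sum_congr rfl fun i _ => ?_
  ring

/-- **The pendant Boltzmann weight factorises**: `w_{c'}(σ') = w_c(σ) · exp(ε ∑_i η_i σ_{x_i})`. [folklore] -/
theorem weight_pend (σ' : SpinConfig (ι ⊕ Fin m)) :
    weight (pend c x ε) σ' = weight c (σ' ∘ Sum.inl) * Real.exp (ε * ∑ i, spinAt (Sum.inr i) σ' * spinAt (Sum.inl (x i)) σ') := by
  rw [weight, weight, sum_sum_pend, Real.exp_add]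

/-- `∑_{u=±1} u e^{ε u s} = 2 s sinh ε` for `s = ±1`. [folklore] -/
theorem sum_units_mul_exp {s : ℝ} (hs : s = 1 ∨ s = -1) :
    ∑ u : ℤˣ, ((u : ℤ) : ℝ) * Real.exp (ε * ((u : ℤ) : ℝ) * s) = 2 * Real.sinh ε * s := by
  rw [UnitsInt.univ, Finset.sum_insert (by decide), Finset.sum_singleton]
  simp only [Units.val_one, Int.cast_one, Units.val_neg, Int.cast_neg]
  rw [Real.sinh_eq]
  rcases hs with rfl | rfl
  · rw [show ε * 1 * 1 = ε by ring, show ε * -1 * 1 = -ε by ring]; ring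
  · rw [show ε * 1 * -1 = -ε by ring, show ε * -1 * -1 = ε by ring]
    have : Real.exp (-ε) = Real.exp (-ε) := rfl
    ring

/-- `∑_{u=±1} e^{ε u s} = 2 cosh ε` for `s = ±1`. [folklore] -/
theorem sum_units_exp {s : ℝ} (hs : s = 1 ∨ s = -1) :
    ∑ u : ℤˣ, Real.exp (ε * ((u : ℤ) : ℝ) * s) = 2 * Real.cosh ε := by
  rw [UnitsInt.univ, Finset.sum_insert (by decide), Finset.sum_singleton]
  simp only [Units.val_one, Int.cast_one, Units.val_neg, Int.cast_neg]
  rw [Real.cosh_eq]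
  rcases hs with rfl | rfl
  · rw [show ε * 1 * 1 = ε by ring, show ε * -1 * 1 = -ε by ring]; ring
  · rw [show ε * 1 * -1 = -ε by ring, show ε * -1 * -1 = ε by ring]; ring

/-- **Summing out the auxiliary spins.** For `I ⊆ Fin m` and an observable `F` of the site spins,
`∑_{σ'} (∏_{i∈I} η_i) F(σ) w_{c'}(σ') = (2 sinh ε)^{|I|} (2 cosh ε)^{m-|I|} ∑_σ (∏_{i∈I} σ_{x_i}) F(σ) w_c(σ)`
(each auxiliary spin is summed independently: `∑_u u e^{εuσ} = 2σ sinh ε`, `∑_u e^{εuσ} = 2cosh ε`). [folklore] -/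
theorem sum_pend_prod_mul (I : Finset (Fin m)) (F : SpinConfig ι → ℝ) :
    ∑ σ' : SpinConfig (ι ⊕ Fin m), (∏ i ∈ I, spinAt (Sum.inr i) σ') * F (σ' ∘ Sum.inl) * weight (pend c x ε) σ' =
      (2 * Real.sinh ε) ^ I.card * (2 * Real.cosh ε) ^ (m - I.card) *
        ∑ σ : SpinConfig ι, (∏ i ∈ I, spinAt (x i) σ) * F σ * weight c σ := by
  classical
  -- split `σ' = (σ, η)`
  have hsplit : ∑ σ' : SpinConfig (ι ⊕ Fin m), (∏ i ∈ I, spinAt (Sum.inr i) σ') * F (σ' ∘ Sum.inl) * weight (pend c x ε) σ' =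
      ∑ σ : SpinConfig ι, ∑ η : SpinConfig (Fin m),
        (∏ i ∈ I, spinAt i η) * F σ * (weight c σ * Real.exp (ε * ∑ i, spinAt i η * spinAt (x i) σ)) := by
    rw [← Fintype.sum_prod_type']
    refine Fintype.sum_equiv (Equiv.sumArrowEquivProdArrow ι (Fin m) ℤˣ) _ _ fun σ' => ?_
    rw [weight_pend]
    rfl
  rw [hsplit]
  -- the sum over `η` factorises
  have hη : ∀ σ : SpinConfig ι, ∑ η : SpinConfig (Fin m),
      (∏ i ∈ I, spinAt i η) * Real.exp (ε * ∑ i, spinAt i η * spinAt (x i) σ) =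
      (2 * Real.sinh ε) ^ I.card * (2 * Real.cosh ε) ^ (m - I.card) * ∏ i ∈ I, spinAt (x i) σ := by
    intro σ
    set g : Fin m → ℤˣ → ℝ := fun i u =>
      (if i ∈ I then ((u : ℤ) : ℝ) else 1) * Real.exp (ε * ((u : ℤ) : ℝ) * spinAt (x i) σ) with hg
    have h1 : ∀ η : SpinConfig (Fin m), (∏ i ∈ I, spinAt i η) * Real.exp (ε * ∑ i, spinAt i η * spinAt (x i) σ) =
        ∏ i, g i (η i) := by
      intro η
      rw [Finset.mul_sum, Real.exp_sum, ← Fintype.prod_ite_mem I (fun i => spinAt i η), ← Finset.prod_mul_distrib]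
      refine Finset.prod_congr rfl fun i _ => ?_
      simp only [hg, spinAt, mul_assoc]
    have h2 : ∀ i, ∑ u : ℤˣ, g i u = if i ∈ I then 2 * Real.sinh ε * spinAt (x i) σ else 2 * Real.cosh ε := by
      intro i
      by_cases hi : i ∈ I
      · simp only [hg, if_pos hi]
        exact sum_units_mul_exp ε (spinAt_eq_one_or_eq_neg_one _ _)
      · simp only [hg, if_neg hi, one_mul]
        exact sum_units_exp ε (spinAt_eq_one_or_eq_neg_one _ _)
    calc ∑ η : SpinConfig (Fin m), (∏ i ∈ I, spinAt i η) * Real.exp (ε * ∑ i, spinAt i η * spinAt (x i) σ)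
        = ∑ η : Fin m → ℤˣ, ∏ i, g i (η i) := Finset.sum_congr rfl fun η _ => h1 η
      _ = ∏ i, ∑ u : ℤˣ, g i u := (Fintype.prod_sum g).symm
      _ = ∏ i, (if i ∈ I then 2 * Real.sinh ε * spinAt (x i) σ else 2 * Real.cosh ε) := Finset.prod_congr rfl fun i _ => h2 i
      _ = (2 * Real.sinh ε) ^ I.card * (2 * Real.cosh ε) ^ (m - I.card) * ∏ i ∈ I, spinAt (x i) σ := by
          rw [Finset.prod_ite, Finset.prod_mul_distrib, Finset.prod_const, Finset.prod_const]
          have hf1 : univ.filter (· ∈ I) = I := by ext i; simp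
          have hf2 : (univ.filter fun i => ¬ i ∈ I).card = m - I.card := by
            rw [Finset.filter_not, hf1, Finset.card_sdiff_of_subset (Finset.subset_univ I), Finset.card_univ, Fintype.card_fin]
          rw [hf1, hf2]
          ring
  have hσ : ∀ σ : SpinConfig ι, ∑ η : SpinConfig (Fin m),
      (∏ i ∈ I, spinAt i η) * F σ * (weight c σ * Real.exp (ε * ∑ i, spinAt i η * spinAt (x i) σ)) =
      (2 * Real.sinh ε) ^ I.card * (2 * Real.cosh ε) ^ (m - I.card) * ((∏ i ∈ I, spinAt (x i) σ) * F σ * weight c σ) := by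
    intro σ
    have h := congrArg (fun r => r * (F σ * weight c σ)) (hη σ)
    simp only [Finset.sum_mul] at h
    calc _ = ∑ η : SpinConfig (Fin m), (∏ i ∈ I, spinAt i η) * Real.exp (ε * ∑ i, spinAt i η * spinAt (x i) σ) *
          (F σ * weight c σ) := Finset.sum_congr rfl fun η _ => by ring
      _ = _ := by rw [h]; ring
  rw [Finset.sum_congr rfl fun σ _ => hσ σ, ← Finset.mul_sum]

/-- **The pendant Gibbs average of `(∏_{i∈I} η_i) F(σ)`** is `tanh(ε)^{|I|} ⟨(∏_{i∈I} σ_{x_i}) F⟩_c`. [folklore] -/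
theorem avg_pend_prod_mul (I : Finset (Fin m)) (F : SpinConfig ι → ℝ) :
    avg (pend c x ε) (fun σ' => (∏ i ∈ I, spinAt (Sum.inr i) σ') * F (σ' ∘ Sum.inl)) =
      (Real.sinh ε / Real.cosh ε) ^ I.card * avg c (fun σ => (∏ i ∈ I, spinAt (x i) σ) * F σ) := by
  have hnum := sum_pend_prod_mul c x ε I F
  have hden := sum_pend_prod_mul c x ε ∅ (fun _ => 1)
  simp only [Finset.prod_empty, one_mul, mul_one, Finset.card_empty, pow_zero, Nat.sub_zero] at hden
  rw [avg, avg, hnum, hden]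
  have hc0 : 0 < 2 * Real.cosh ε := by positivity
  have hIm : I.card ≤ m := by simpa using Finset.card_le_univ I
  have hpow : (2 * Real.cosh ε) ^ m = (2 * Real.cosh ε) ^ I.card * (2 * Real.cosh ε) ^ (m - I.card) := by
    rw [← pow_add, Nat.add_sub_cancel' hIm]
  rw [hpow, div_pow]
  have hZ : (∑ σ : SpinConfig ι, weight c σ) ≠ 0 := (sum_weight_pos c).ne'
  field_simp
  ring

/-! ### The pair-interaction state as random-current ratios -/

/-- **Dictionary**: `⟨σ_A⟩_c = Z_K[A]/Z_K[∅]` for `c ≥ 0`, with the couplings `K = pairEdgeWeight c 2`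
(`K_{{a,b}} = c_{a,b} + c_{b,a}`) on the complete graph (`pairGibbs_spinProduct_eq_wcurrentSum_div`).
[cite: Panis2023Triviality, §4.1] -/
theorem avg_spinProduct_eq_ratio (hc : ∀ a b, 0 ≤ c a b) (A : Finset ι) :
    avg c (spinProduct A) = wcurrentSum (pairEdgeWeight c 2) A / wcurrentSum (pairEdgeWeight c 2) ∅ := by
  have h := pairGibbs_spinProduct_eq_wcurrentSum_div (J := c) (β := 2) (by norm_num) hc A
  have hw : ∀ σ : SpinConfig ι, Real.exp (2 / 2 * ∑ a, ∑ b, c a b * spinAt a σ * spinAt b σ) = weight c σ := by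
    intro σ
    rw [weight, show (2 : ℝ) / 2 = 1 by norm_num, one_mul]
    simp only [mul_assoc]
  simp only [hw] at h
  rw [avg]
  exact h

/-! ### Scaling of the pairing functional and nonnegativity -/

omit [Fintype ι] [DecidableEq ι] in
/-- If `S'(yᵢ,yⱼ) = r S(zᵢ,zⱼ)` for all distinct indices then `𝒢_k[S'](y) = rᵏ 𝒢_k[S](z)` (every pairing uses
`k` pairs of distinct indices). [folklore] -/
theorem pairingSum_eq_pow_mul {α α' : Type*} (S : α → α → ℝ) (S' : α' → α' → ℝ) (r : ℝ) (k : ℕ)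
    (z : Fin (2 * k) → α) (y : Fin (2 * k) → α') (h : ∀ i j, i ≠ j → S' (y i) (y j) = r * S (z i) (z j)) :
    pairingSum S' k y = r ^ k * pairingSum S k z := by
  unfold pairingSum
  have hτ : ∀ τ : Equiv.Perm (Fin (2 * k)),
      ∏ j : Fin k, S' (y (τ (pairIdx k (j, 0)))) (y (τ (pairIdx k (j, 1)))) =
        r ^ k * ∏ j : Fin k, S (z (τ (pairIdx k (j, 0)))) (z (τ (pairIdx k (j, 1)))) := by
    intro τ
    have hne : ∀ j : Fin k, τ (pairIdx k (j, 0)) ≠ τ (pairIdx k (j, 1)) := fun j hj => by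
      have := (pairIdx k).injective (τ.injective hj)
      simp at this
    rw [Finset.prod_congr rfl fun j _ => h _ _ (hne j), Finset.prod_mul_distrib, Finset.prod_const, Finset.card_univ,
      Fintype.card_fin]
  rw [Finset.sum_congr rfl fun τ _ => hτ τ, ← Finset.mul_sum]
  ring

omit [Fintype ι] [DecidableEq ι] in
/-- `𝒢_k[S] ≥ 0` for `S ≥ 0`. [folklore] -/
theorem pairingSum_nonneg' {α : Type*} {S : α → α → ℝ} (hS : ∀ a b, 0 ≤ S a b) (k : ℕ) (z : Fin (2 * k) → α) :
    0 ≤ pairingSum S k z := by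
  unfold pairingSum
  exact mul_nonneg (by positivity) (Finset.sum_nonneg fun τ _ => Finset.prod_nonneg fun j _ => hS _ _)

omit [Fintype ι] [DecidableEq ι] in
/-- `wickRemainder S U n x ≥ 0` for `S ≥ 0`. [folklore] -/
theorem wickRemainder_nonneg {α : Type*} {S : α → α → ℝ} (hS : ∀ a b, 0 ≤ S a b) (U : (Fin 4 → α) → ℝ) (n : ℕ)
    (z : Fin (2 * n) → α) : 0 ≤ wickRemainder S U n z :=
  Finset.sum_nonneg fun _ _ => mul_nonneg (abs_nonneg _) (pairingSum_nonneg' hS _ _)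

/-! ### The pendant two-point and `2n`-point functions -/

omit [Fintype ι] in
/-- `{a} Δ {b} = {a, b}` for `a ≠ b`. [folklore] -/
theorem singleton_symmDiff_singleton {V : Type*} [DecidableEq V] {a b : V} (h : a ≠ b) :
    (({a} : Finset V) ∆ {b}) = {a, b} := by
  ext w
  simp only [Finset.mem_symmDiff, Finset.mem_singleton, Finset.mem_insert]
  grind

/-- `0 ≤ ⟨σ_aσ_b⟩_c ≤ 1` (`c ≥ 0`). [cite: GriffithsHurstSherman1970] -/
theorem avg_spinPair_mem (hc : ∀ a b, 0 ≤ c a b) (a b : ι) : 0 ≤ avg c (spinPair a b) ∧ avg c (spinPair a b) ≤ 1 := by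
  constructor
  · by_cases hab : a = b
    · subst hab
      have : spinPair a a = fun _ => (1 : ℝ) := by funext σ; exact spinAt_mul_self a σ
      rw [this, avg_const]; exact zero_le_one
    · have : spinPair a b = spinProduct ({a, b} : Finset ι) := by
        funext σ; rw [spinPair, spinProduct, Finset.prod_pair hab]
      rw [this]; exact avg_spinProduct_nonneg hc _
  · rw [avg, div_le_one (sum_weight_pos c)]
    refine Finset.sum_le_sum fun σ _ => ?_
    have h1 : spinPair a b σ ≤ 1 := by
      rw [spinPair]
      rcases spinAt_eq_one_or_eq_neg_one a σ with h | h <;> rcases spinAt_eq_one_or_eq_neg_one b σ with h' | h' <;>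
        rw [h, h'] <;> norm_num
    calc spinPair a b σ * weight c σ ≤ 1 * weight c σ := mul_le_mul_of_nonneg_right h1 (weight_pos c σ).le
      _ = weight c σ := one_mul _

variable {c x ε}

/-- The pendant model's random-current ratio of a vertex set is its Gibbs average (`c, ε ≥ 0`). [folklore] -/
theorem ratio_pend_eq_avg (hc : ∀ a b, 0 ≤ c a b) (hε : 0 ≤ ε) (A : Finset (ι ⊕ Fin m)) :
    wcurrentSum (pairEdgeWeight (pend c x ε) 2) A / wcurrentSum (pairEdgeWeight (pend c x ε) 2) ∅ =
      avg (pend c x ε) (spinProduct A) :=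
  (avg_spinProduct_eq_ratio (pend c x ε) (pend_nonneg c x ε hc hε) A).symm

/-- **All auxiliary spins**: `⟨∏_i η_i⟩_{c'} = t^m ⟨σ_{x_1}⋯σ_{x_m}⟩_c`, `t = tanh ε`. [folklore] -/
theorem avg_pend_spinProduct_image :
    avg (pend c x ε) (spinProduct ((univ : Finset (Fin m)).image Sum.inr)) =
      (Real.sinh ε / Real.cosh ε) ^ m * avg c (spinMonomial x) := by
  have h := avg_pend_prod_mul c x ε univ (fun _ => 1)
  simp only [mul_one, Finset.card_univ, Fintype.card_fin] at h
  have hsp : spinProduct ((univ : Finset (Fin m)).image Sum.inr) = fun σ' : SpinConfig (ι ⊕ Fin m) => ∏ i, spinAt (Sum.inr i) σ' := by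
    funext σ'
    rw [spinProduct, Finset.prod_image fun i _ j _ hij => Sum.inr_injective hij]
  rw [hsp, h]
  rfl

/-- **Two distinct auxiliary spins**: `⟨η_iη_j⟩_{c'} = t² ⟨σ_{x_i}σ_{x_j}⟩_c`. [folklore] -/
theorem avg_pend_pair_inr_inr {i j : Fin m} (hij : i ≠ j) :
    avg (pend c x ε) (spinProduct ({Sum.inr i} ∆ {Sum.inr j} : Finset (ι ⊕ Fin m))) =
      (Real.sinh ε / Real.cosh ε) ^ 2 * avg c (spinPair (x i) (x j)) := by
  have h := avg_pend_prod_mul c x ε {i, j} (fun _ => 1)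
  simp only [mul_one, Finset.card_pair hij] at h
  have hsp : spinProduct ({Sum.inr i} ∆ {Sum.inr j} : Finset (ι ⊕ Fin m)) =
      fun σ' : SpinConfig (ι ⊕ Fin m) => ∏ k ∈ ({i, j} : Finset (Fin m)), spinAt (Sum.inr k) σ' := by
    funext σ'
    rw [singleton_symmDiff_singleton (fun h => hij (Sum.inr_injective h)), spinProduct,
      Finset.prod_pair (fun h => hij (Sum.inr_injective h)), Finset.prod_pair hij]
  rw [hsp, h]
  congr 1
  congr 1
  funext σ
  rw [Finset.prod_pair hij, spinPair]

/-- **An auxiliary spin and a site**: `⟨η_i σ_v⟩_{c'} = t ⟨σ_{x_i}σ_v⟩_c`. [folklore] -/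
theorem avg_pend_pair_inr_inl (i : Fin m) (v : ι) :
    avg (pend c x ε) (spinProduct ({Sum.inr i} ∆ {Sum.inl v} : Finset (ι ⊕ Fin m))) =
      (Real.sinh ε / Real.cosh ε) * avg c (spinPair (x i) v) := by
  have h := avg_pend_prod_mul c x ε {i} (fun σ => spinAt v σ)
  simp only [Finset.prod_singleton, Finset.card_singleton, pow_one] at h
  have hsp : spinProduct ({Sum.inr i} ∆ {Sum.inl v} : Finset (ι ⊕ Fin m)) =
      fun σ' : SpinConfig (ι ⊕ Fin m) => spinAt (Sum.inr i) σ' * spinAt v (σ' ∘ Sum.inl) := by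
    funext σ'
    rw [singleton_symmDiff_singleton Sum.inr_ne_inl, spinProduct, Finset.prod_pair Sum.inr_ne_inl]
    rfl
  rw [hsp, h]
  rfl

/-- `0 ≤ sinh ε / cosh ε ≤ 1` for `ε ≥ 0`. [folklore] -/
theorem sinh_div_cosh_mem (hε : 0 ≤ ε) : 0 ≤ Real.sinh ε / Real.cosh ε ∧ Real.sinh ε / Real.cosh ε ≤ 1 := by
  have hcpos := Real.cosh_pos ε
  refine ⟨div_nonneg (Real.sinh_nonneg_iff.2 hε) hcpos.le, ?_⟩
  rw [div_le_one hcpos]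
  exact (Real.sinh_lt_cosh ε).le

/-- **The tree diagram of four distinct auxiliary spins in the pendant model** is at most
`t⁴ T(x_{u}) + m t⁶`: the site vertices contribute `t⁴ ∑_v ∏_j ⟨σ_{x_{u_j}}σ_v⟩`, and each of the `m`
auxiliary vertices a product of at least three factors `≤ t²`. [folklore] -/
theorem pend_tree_le (hc : ∀ a b, 0 ≤ c a b) (hε : 0 ≤ ε) {u : Fin 4 → Fin m} (hu : Function.Injective u) :
    ∑ v' : ι ⊕ Fin m, ∏ j : Fin 4, avg (pend c x ε) (spinProduct ({Sum.inr (u j)} ∆ {v'} : Finset (ι ⊕ Fin m))) ≤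
      (Real.sinh ε / Real.cosh ε) ^ 4 * ∑ v : ι, ∏ j : Fin 4, avg c (spinPair (x (u j)) v) +
        m * (Real.sinh ε / Real.cosh ε) ^ 6 := by
  set t : ℝ := Real.sinh ε / Real.cosh ε with ht
  obtain ⟨ht0, ht1⟩ := sinh_div_cosh_mem (ε := ε) hε
  rw [Fintype.sum_sum_type]
  refine add_le_add (le_of_eq ?_) ?_
  · rw [Finset.mul_sum]
    refine Finset.sum_congr rfl fun v _ => ?_
    rw [Finset.prod_congr rfl fun j _ => avg_pend_pair_inr_inl (c := c) (x := x) (ε := ε) (u j) v,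
      Finset.prod_mul_distrib, Finset.prod_const, Finset.card_univ, Fintype.card_fin]
  · have hk : ∀ k : Fin m, ∏ j : Fin 4, avg (pend c x ε) (spinProduct ({Sum.inr (u j)} ∆ {Sum.inr k} : Finset (ι ⊕ Fin m))) ≤ t ^ 6 := by
      intro k
      have hnn : ∀ j, 0 ≤ avg (pend c x ε) (spinProduct ({Sum.inr (u j)} ∆ {Sum.inr k} : Finset (ι ⊕ Fin m))) :=
        fun j => avg_spinProduct_nonneg (pend_nonneg c x ε hc hε) _
      have hle : ∀ j, u j ≠ k → avg (pend c x ε) (spinProduct ({Sum.inr (u j)} ∆ {Sum.inr k} : Finset (ι ⊕ Fin m))) ≤ t ^ 2 := by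
        intro j hj
        rw [avg_pend_pair_inr_inr hj, ← ht]
        calc t ^ 2 * avg c (spinPair (x (u j)) (x k)) ≤ t ^ 2 * 1 :=
              mul_le_mul_of_nonneg_left (avg_spinPair_mem c hc _ _).2 (pow_nonneg ht0 2)
          _ = t ^ 2 := mul_one _
      by_cases hex : ∃ j₀, u j₀ = k
      · obtain ⟨j₀, hj₀⟩ := hex
        have h1 : avg (pend c x ε) (spinProduct ({Sum.inr (u j₀)} ∆ {Sum.inr k} : Finset (ι ⊕ Fin m))) = 1 := by
          rw [hj₀, symmDiff_self, Finset.bot_eq_empty]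
          have : spinProduct (∅ : Finset (ι ⊕ Fin m)) = fun _ => (1 : ℝ) := by funext σ; simp [spinProduct]
          rw [this, avg_const]
        rw [← Finset.mul_prod_erase _ _ (Finset.mem_univ j₀), h1, one_mul]
        calc ∏ j ∈ univ.erase j₀, avg (pend c x ε) (spinProduct ({Sum.inr (u j)} ∆ {Sum.inr k} : Finset (ι ⊕ Fin m)))
            ≤ ∏ j ∈ univ.erase j₀, t ^ 2 :=
              Finset.prod_le_prod (fun j _ => hnn j) fun j hj =>
                hle j (fun h => Finset.ne_of_mem_erase hj (hu (h.trans hj₀.symm)))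
          _ = t ^ 6 := by
              rw [Finset.prod_const, Finset.card_erase_of_mem (Finset.mem_univ j₀), Finset.card_univ, Fintype.card_fin]
              ring
      · push Not at hex
        calc ∏ j : Fin 4, avg (pend c x ε) (spinProduct ({Sum.inr (u j)} ∆ {Sum.inr k} : Finset (ι ⊕ Fin m)))
            ≤ ∏ _j : Fin 4, t ^ 2 := Finset.prod_le_prod (fun j _ => hnn j) fun j _ => hle j (hex j)
          _ = t ^ 6 * t ^ 2 := by rw [Finset.prod_const, Finset.card_univ, Fintype.card_fin]; ring
          _ ≤ t ^ 6 * 1 := mul_le_mul_of_nonneg_left (by nlinarith) (pow_nonneg ht0 6)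
          _ = t ^ 6 := mul_one _
    calc ∑ k : Fin m, ∏ j : Fin 4, avg (pend c x ε) (spinProduct ({Sum.inr (u j)} ∆ {Sum.inr k} : Finset (ι ⊕ Fin m)))
        ≤ ∑ _k : Fin m, t ^ 6 := Finset.sum_le_sum fun k _ => hk k
      _ = m * t ^ 6 := by rw [Finset.sum_const, Finset.card_univ, Fintype.card_fin, nsmul_eq_mul]

/-! ### The headline: pair-interaction Gibbs states, arbitrary (possibly coincident) points -/

/-- The inequality for `n ≥ 2`, for every `ε > 0` (pendant model with `2n` distinct auxiliary points,
`Current.abs_ratio_image_sub_pairingSum_le`, and the evaluation of the pendant correlations). [folklore] -/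
theorem abs_sub_pairingSum_le_add (hc : ∀ a b, 0 ≤ c a b) {n : ℕ} (hn : 2 ≤ n) (x : Fin (2 * n) → ι)
    {ε : ℝ} (hε : 0 < ε) :
    |avg c (spinMonomial x) - pairingSum (fun a b => avg c (spinPair a b)) n x| ≤
      2 * wickRemainder (fun a b => avg c (spinPair a b)) (fun u => ∑ v, ∏ j, avg c (spinPair (u j) v)) n x +
        2 * ((2 * n : ℕ) * (Real.sinh ε / Real.cosh ε) ^ 2 *
          ∑ s : {s : Finset (Fin (2 * n)) // s.card = 4},
            pairingSum (fun a b => avg c (spinPair a b)) (n - 2) (removeFour₂ x s)) := by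
  set t : ℝ := Real.sinh ε / Real.cosh ε with ht
  obtain ⟨ht0, ht1⟩ := sinh_div_cosh_mem (ε := ε) hε.le
  have htpos : 0 < t := div_pos (Real.sinh_pos_iff.2 hε) (Real.cosh_pos ε)
  set S₂ : ι → ι → ℝ := fun a b => avg c (spinPair a b) with hS₂
  have hS₂nn : ∀ a b, 0 ≤ S₂ a b := fun a b => (avg_spinPair_mem c hc a b).1
  -- the pendant model and the distinct-point bound, in Gibbs averages
  set K' : (⊤ : SimpleGraph (ι ⊕ Fin (2 * n))).edgeFinset → ℝ := pairEdgeWeight (pend c x ε) 2 with hK'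
  have hK'nn : ∀ e, 0 ≤ K' e := pairEdgeWeight_nonneg (by norm_num) (pend_nonneg c x ε hc hε.le)
  have key := Current.abs_ratio_image_sub_pairingSum_le (K := K') hK'nn (x := (Sum.inr : Fin (2 * n) → ι ⊕ Fin (2 * n)))
    Sum.inr_injective
  have hWavg : ∀ A, wcurrentSum K' A / wcurrentSum K' ∅ = avg (pend c x ε) (spinProduct A) :=
    fun A => ratio_pend_eq_avg hc hε.le A
  simp only [hWavg] at key
  -- the `2n`-point function
  have h1 : avg (pend c x ε) (spinProduct ((univ : Finset (Fin (2 * n))).image Sum.inr)) =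
      t ^ (2 * n) * avg c (spinMonomial x) := avg_pend_spinProduct_image
  -- the pairing sum of the auxiliary points
  have hpair : ∀ i j : Fin (2 * n), i ≠ j →
      avg (pend c x ε) (spinProduct ({Sum.inr i} ∆ {Sum.inr j} : Finset (ι ⊕ Fin (2 * n)))) = t ^ 2 * S₂ (x i) (x j) :=
    fun i j hij => avg_pend_pair_inr_inr hij
  have h2 : pairingSum (fun a b => avg (pend c x ε) (spinProduct ({a} ∆ {b}))) n Sum.inr = (t ^ 2) ^ n * pairingSum S₂ n x :=
    pairingSum_eq_pow_mul S₂ (fun a b => avg (pend c x ε) (spinProduct ({a} ∆ {b}))) (t ^ 2) n x Sum.inr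
      fun i j hij => hpair i j hij
  -- the remainder
  have h3 : wickRemainder (fun a b => avg (pend c x ε) (spinProduct ({a} ∆ {b})))
      (fun u => ∑ v, ∏ j, avg (pend c x ε) (spinProduct ({u j} ∆ {v}))) n Sum.inr ≤
      (t ^ 2) ^ (n - 2) * (t ^ 4 * wickRemainder S₂ (fun u => ∑ v, ∏ j, S₂ (u j) v) n x +
        (2 * n : ℕ) * t ^ 6 * ∑ s : {s : Finset (Fin (2 * n)) // s.card = 4}, pairingSum S₂ (n - 2) (removeFour₂ x s)) := by
    unfold wickRemainder
    rw [mul_add, Finset.mul_sum, Finset.mul_sum, Finset.mul_sum, Finset.mul_sum, ← Finset.sum_add_distrib]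
    refine Finset.sum_le_sum fun s _ => ?_
    -- the pairing sum of the remaining auxiliary points
    have hrem : pairingSum (fun a b => avg (pend c x ε) (spinProduct ({a} ∆ {b}))) (n - 2) (removeFour₂ Sum.inr s) =
        (t ^ 2) ^ (n - 2) * pairingSum S₂ (n - 2) (removeFour₂ x s) := by
      rw [removeFour₂_eq_comp, removeFour₂_eq_comp]
      exact pairingSum_eq_pow_mul S₂ _ (t ^ 2) (n - 2) _ _ fun i j hij => hpair _ _ fun h => hij ((complEnum s).injective h)
    -- the tree diagram of the four selected auxiliary points
    have hinj : Function.Injective (s.1.orderEmbOfFin s.2) := (s.1.orderEmbOfFin s.2).injective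
    have hnn : 0 ≤ ∑ v, ∏ j, avg (pend c x ε) (spinProduct ({restrictFour Sum.inr s j} ∆ {v})) :=
      Finset.sum_nonneg fun v _ => Finset.prod_nonneg fun j _ => avg_spinProduct_nonneg (pend_nonneg c x ε hc hε.le) _
    have hnn' : 0 ≤ ∑ v, ∏ j, S₂ (restrictFour x s j) v :=
      Finset.sum_nonneg fun v _ => Finset.prod_nonneg fun j _ => hS₂nn _ _
    have htree : |∑ v, ∏ j, avg (pend c x ε) (spinProduct ({restrictFour Sum.inr s j} ∆ {v}))| ≤
        t ^ 4 * |∑ v, ∏ j, S₂ (restrictFour x s j) v| + (2 * n : ℕ) * t ^ 6 := by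
      rw [abs_of_nonneg hnn, abs_of_nonneg hnn']
      exact pend_tree_le (c := c) (x := x) (ε := ε) hc hε.le hinj
    have hG0 : 0 ≤ pairingSum S₂ (n - 2) (removeFour₂ x s) := pairingSum_nonneg' hS₂nn _ _
    rw [hrem]
    calc |∑ v, ∏ j, avg (pend c x ε) (spinProduct ({restrictFour Sum.inr s j} ∆ {v}))| *
          ((t ^ 2) ^ (n - 2) * pairingSum S₂ (n - 2) (removeFour₂ x s))
        ≤ (t ^ 4 * |∑ v, ∏ j, S₂ (restrictFour x s j) v| + (2 * n : ℕ) * t ^ 6) *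
            ((t ^ 2) ^ (n - 2) * pairingSum S₂ (n - 2) (removeFour₂ x s)) :=
          mul_le_mul_of_nonneg_right htree (mul_nonneg (pow_nonneg (pow_nonneg ht0 2) _) hG0)
      _ = _ := by ring
  -- assemble and divide by `t^{2n}`
  rw [h1, h2] at key
  have hpow : (t ^ 2) ^ n = t ^ (2 * n) := by rw [← pow_mul]
  have hpow' : (t ^ 2) ^ (n - 2) * t ^ 4 = t ^ (2 * n) := by
    rw [← pow_mul, ← pow_add]; congr 1; omega
  rw [hpow, ← mul_sub, abs_mul, abs_of_nonneg (pow_nonneg ht0 _)] at key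
  have key' := key.trans (mul_le_mul_of_nonneg_left h3 (by norm_num))
  have hfin : t ^ (2 * n) * |avg c (spinMonomial x) - pairingSum S₂ n x| ≤
      t ^ (2 * n) * (2 * wickRemainder S₂ (fun u => ∑ v, ∏ j, S₂ (u j) v) n x +
        2 * ((2 * n : ℕ) * t ^ 2 * ∑ s : {s : Finset (Fin (2 * n)) // s.card = 4}, pairingSum S₂ (n - 2) (removeFour₂ x s))) := by
    calc _ ≤ _ := key'
      _ = _ := by rw [← hpow']; ring
  exact le_of_mul_le_mul_left hfin (pow_pos htpos _)

/-- **The tree-graph bound on the deviation from Wick's law for finite pair-interaction Ising models.**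
For a finite set `ι`, couplings `c ≥ 0` (Gibbs weight `exp(∑_{a,b} c_{ab}σ_aσ_b)`, free boundary, zero
field), every `n` and every `x : Fin (2n) → ι` (coincident points allowed),
`|⟨σ_{x₁}⋯σ_{x_{2n}}⟩ - 𝒢_n[⟨σσ⟩](x)| ≤ 2 ∑_{|s|=4} T(x_s) 𝒢_{n-2}[⟨σσ⟩](x^{(s̸)})`,
`T(u) = ∑_v ∏_j ⟨σ_{u_j}σ_v⟩` — the tree-diagram form of Aizenman's bound (Aizenman 1982, Prop. 12.1 with the
tree diagram bound Prop. 5.3; Panis 2023, Prop. 4.6 with §4.2), constant `2`. Distinct points: random currents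
(`Current.abs_ratio_image_sub_pairingSum_le`); coincident points: `2n` auxiliary pendant spins with coupling
`ε → 0`. [cite: AizenmanCMP1982, Prop. 12.1 and Prop. 5.3] [cite: Panis2023Triviality, Prop. 4.6 and §4.2 (tree diagram bound)] [cite: BrydgesFrohlichSokal1983, §4 eqs. (4.13)–(4.15)] -/
theorem abs_avg_spinMonomial_sub_pairingSum_le (c : ι → ι → ℝ) (hc : ∀ a b, 0 ≤ c a b) (n : ℕ)
    (x : Fin (2 * n) → ι) :
    |avg c (spinMonomial x) - pairingSum (fun a b => avg c (spinPair a b)) n x| ≤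
      2 * wickRemainder (fun a b => avg c (spinPair a b)) (fun u => ∑ v, ∏ j, avg c (spinPair (u j) v)) n x := by
  have hS₂nn : ∀ a b, 0 ≤ avg c (spinPair a b) := fun a b => (avg_spinPair_mem c hc a b).1
  have hsymm : ∀ a b : ι, avg c (spinPair a b) = avg c (spinPair b a) := fun a b => by
    rw [show spinPair a b = spinPair b a from funext fun σ => mul_comm _ _]
  have hR0 : 0 ≤ wickRemainder (fun a b => avg c (spinPair a b)) (fun u => ∑ v, ∏ j, avg c (spinPair (u j) v)) n x :=
    wickRemainder_nonneg hS₂nn _ n x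
  rcases Nat.lt_or_ge n 2 with hn | hn
  · -- `n ≤ 1`: the left side vanishes
    have h0 : avg c (spinMonomial x) - pairingSum (fun a b => avg c (spinPair a b)) n x = 0 := by
      interval_cases n
      · rw [pairingSum_zero]
        haveI : IsEmpty (Fin (2 * 0)) := ⟨fun i => i.elim0⟩
        have : spinMonomial x = fun _ => (1 : ℝ) := by funext σ; exact Fintype.prod_empty _
        rw [this, avg_const, sub_self]
      · rw [pairingSum_one _ hsymm]
        have : spinMonomial x = spinPair (x 0) (x 1) := by
          funext σ
          show ∏ i : Fin 2, spinAt (x i) σ = _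
          rw [Fin.prod_univ_two]
          rfl
        rw [this, sub_self]
    rw [h0, abs_zero]
    positivity
  · -- `n ≥ 2`: pendant spins and `ε → 0`
    set C : ℝ := 2 * ((2 * n : ℕ) * ∑ s : {s : Finset (Fin (2 * n)) // s.card = 4},
      pairingSum (fun a b => avg c (spinPair a b)) (n - 2) (removeFour₂ x s)) with hC
    have hε : ∀ ε : ℝ, 0 < ε → |avg c (spinMonomial x) - pairingSum (fun a b => avg c (spinPair a b)) n x| ≤
        2 * wickRemainder (fun a b => avg c (spinPair a b)) (fun u => ∑ v, ∏ j, avg c (spinPair (u j) v)) n x +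
          C * (Real.sinh ε / Real.cosh ε) ^ 2 := by
      intro ε hε
      have h := abs_sub_pairingSum_le_add hc hn x hε
      calc _ ≤ _ := h
        _ = _ := by rw [hC]; ring
    -- the right-hand side tends to the claim as `ε → 0⁺`
    have hlim : Tendsto (fun ε : ℝ => 2 * wickRemainder (fun a b => avg c (spinPair a b))
        (fun u => ∑ v, ∏ j, avg c (spinPair (u j) v)) n x + C * (Real.sinh ε / Real.cosh ε) ^ 2)
        (𝓝[>] 0) (𝓝 (2 * wickRemainder (fun a b => avg c (spinPair a b))
          (fun u => ∑ v, ∏ j, avg c (spinPair (u j) v)) n x + C * (Real.sinh 0 / Real.cosh 0) ^ 2)) := by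
      refine tendsto_nhdsWithin_of_tendsto_nhds (Continuous.tendsto ?_ 0)
      exact continuous_const.add (continuous_const.mul ((Real.continuous_sinh.div Real.continuous_cosh
        fun e => (Real.cosh_pos e).ne').pow 2))
    rw [Real.sinh_zero, zero_div, zero_pow two_ne_zero, mul_zero, add_zero] at hlim
    exact ge_of_tendsto hlim (eventually_nhdsWithin_of_forall fun ε hε' => hε ε hε')

end PairIsing

/-! ### Smearing a remainder bound with an arbitrary four-point weight (generalises `AizenmanWickBoundLocal`) -/

section Smearing

open MeasureTheory
open scoped Nat

variable {d : ℕ}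

/-- **Smearing a pairing-form inequality with an arbitrary four-point weight `U` and constant `c_W ≥ 0`.**
If the correlation functions of the probability measure `μ` on `{±1}^{ℤ^d}` satisfy, for all `n ≥ 2` and
all `x₁,…,x_{2n} ∈ Λ_{rL}`, `|S_{2n}(x) - 𝒢_n[S₂](x)| ≤ c_W ∑_{|s|=4} |U(x_s)| 𝒢_{n-2}[S₂](x^{(s̸)})`, then for
`L > 0`, `f` continuous vanishing off `[-r,r]^d` and `n ≥ 2`,
`|⟨T_{f,L}^{2n}⟩ - (2n)!/(2ⁿn!) ⟨T_{f,L}²⟩ⁿ| ≤ c_W (2n)⁴ ‖f‖_∞⁴ (∑_{u∈Λ_{rL}⁴} |U(u)| / Σ_L²) · (2n-4)!/(2^{n-2}(n-2)!) ⟨T_{|f|,L}²⟩^{n-2}`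
— verbatim the proof of `abs_integral_normalizedField_pow_sub_le_of_wickDeviationBoundOn` (which is the
case `c_W = 3/2`, `U = U₄^μ`); used with the tree diagram `U = T` and `c_W = 2`.
[cite: AizenmanCDM2020, Prop. 7.2 and §7 eqs. (7.6), (7.9)–(7.10)] [cite: Panis2023Triviality, proof of Thm. 5.5, first display (p. 21)] -/
theorem abs_integral_normalizedField_pow_sub_le_of_remainderBoundOn
    {μ : Measure (SpinConfig (Site d))} [IsProbabilityMeasure μ] {L r : ℝ} (hL : 0 < L)
    {cW : ℝ} (hcW : 0 ≤ cW) (U : (Fin 4 → Site d) → ℝ)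
    (hW : ∀ n : ℕ, 2 ≤ n → ∀ x : Fin (2 * n) → Site d, (∀ i, x i ∈ latticeBox d (r * L)) →
      |nPoint μ spinAt x - pairingSum (twoPoint μ spinAt) n x| ≤
        cW * wickRemainder (twoPoint μ spinAt) U n x)
    {f : EuclideanSpace ℝ (Fin d) → ℝ} (hf : Continuous f) (hfr : ∀ x, f x ≠ 0 → ∀ i, |x i| ≤ r)
    {n : ℕ} (hn : 2 ≤ n) :
    |(∫ σ, normalizedField μ L f σ ^ (2 * n) ∂μ) -
        ((2 * n)! : ℝ) / (2 ^ n * n !) * (∫ σ, normalizedField μ L f σ ^ 2 ∂μ) ^ n|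
      ≤ cW * (2 * n : ℝ) ^ 4 * (⨆ x, |f x|) ^ 4 *
          ((∑ u ∈ Fintype.piFinset (fun _ : Fin 4 => latticeBox d (r * L)), |U u|) / blockSpinVariance μ L ^ 2) *
          (((2 * (n - 2))! : ℝ) / (2 ^ (n - 2) * (n - 2)!) *
            (∫ σ, normalizedField μ L (fun x => |f x|) σ ^ 2 ∂μ) ^ (n - 2)) := by
  have hLne : L ≠ 0 := hL.ne'
  have hfar : ∀ x, (fun y => |f y|) x ≠ 0 → ∀ i, |x i| ≤ r := fun x hx =>
    hfr x (abs_ne_zero.mp hx)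
  have hbox : latticeBox d (r / |L⁻¹|) = latticeBox d (r * L) := by
    rw [abs_inv, abs_of_pos hL, div_inv_eq_mul]
  -- notation
  set Λ : Finset (Site d) := latticeBox d (r / |L⁻¹|) with hΛ
  set c : ℝ := (Real.sqrt (blockSpinVariance μ L))⁻¹ with hc
  set g : Site d → ℝ := fun a => f (L⁻¹ • siteVec a) with hg
  set S₂ : Site d → Site d → ℝ := twoPoint μ spinAt with hS₂
  set G : (Fin (2 * n) → Site d) → ℝ := fun p => pairingSum S₂ n p with hG
  set P : (Fin (2 * n - 4) → Site d) → ℝ := fun q =>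
    pairingSum S₂ (n - 2) (q ∘ Fin.cast (two_mul_sub_two n)) with hP
  set γ : ℝ := ((2 * (n - 2))! : ℝ) / (2 ^ (n - 2) * (n - 2)!) with hγ
  set A : ℝ := ∑ q ∈ Fintype.piFinset (fun _ : Fin (2 * n - 4) => Λ), (∏ j, |g (q j)|) * P q
    with hA
  set B : ℝ := ∑ u ∈ Fintype.piFinset (fun _ : Fin 4 => Λ), (∏ j, |g (u j)|) * |U u| with hB
  set Us : ℝ := ∑ u ∈ Fintype.piFinset (fun _ : Fin 4 => Λ), |U u| with hUs
  set V₂ : ℝ := ∑ a ∈ Λ, ∑ b ∈ Λ, |g a| * |g b| * S₂ a b with hV₂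
  set M : ℝ := ⨆ x, |f x| with hM
  have hM0 : 0 ≤ M := iSup_abs_nonneg f
  have hgM : ∀ a, |g a| ≤ M := by
    have hbdd : BddAbove (Set.range fun x => |f x|) :=
      (hf.abs).bddAbove_range_of_hasCompactSupport
        ((hasCompactSupport_of_cube hfr).comp_left abs_zero)
    intro a
    exact le_ciSup hbdd _
  have hc0 : 0 ≤ c := inv_nonneg.mpr (Real.sqrt_nonneg _)
  have hγ0 : 0 ≤ γ := by rw [hγ]; positivity
  have hSig0 : 0 ≤ blockSpinVariance μ L := integral_nonneg fun σ => sq_nonneg _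
  have hB0 : 0 ≤ B := Finset.sum_nonneg fun u _ =>
    mul_nonneg (Finset.prod_nonneg fun j _ => abs_nonneg _) (abs_nonneg _)
  -- the smeared Wick functional of the remaining points and the second moment of `T_{|f|,L}`
  have hAeq : A = γ * V₂ ^ (n - 2) := by
    rw [hA, hγ, hV₂, hP, sum_piFinset_prod_mul_comp_cast (two_mul_sub_two n) Λ (fun a => |g a|)
      (pairingSum S₂ (n - 2))]
    exact sum_prod_mul_pairingSum Λ (fun a => |g a|) S₂ (n - 2)
  have hmom2 : ∫ σ, normalizedField μ L (fun x => |f x|) σ ^ 2 ∂μ = c ^ 2 * V₂ := by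
    rw [integral_normalizedField_sq_eq_sum₂ μ hLne hfar]
  have hmom2_0 : 0 ≤ ∫ σ, normalizedField μ L (fun x => |f x|) σ ^ 2 ∂μ :=
    integral_nonneg fun σ => sq_nonneg _
  have hS : (∑ u ∈ Fintype.piFinset (fun _ : Fin 4 => latticeBox d (r * L)), |U u|) / blockSpinVariance μ L ^ 2 =
      Us / blockSpinVariance μ L ^ 2 := by
    rw [hUs, hbox]
  have hUs0 : 0 ≤ Us := Finset.sum_nonneg fun u _ => abs_nonneg _
  have hS0 : 0 ≤ (∑ u ∈ Fintype.piFinset (fun _ : Fin 4 => latticeBox d (r * L)), |U u|) / blockSpinVariance μ L ^ 2 := by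
    rw [hS]; exact div_nonneg hUs0 (sq_nonneg _)
  have hBle : B ≤ M ^ 4 * Us := by
    rw [hB, hUs, Finset.mul_sum]
    refine Finset.sum_le_sum fun u _ => ?_
    have hprod : ∏ j, |g (u j)| ≤ M ^ 4 := by
      calc ∏ j, |g (u j)| ≤ ∏ _j : Fin 4, M :=
            Finset.prod_le_prod (fun j _ => abs_nonneg _) fun j _ => hgM _
        _ = M ^ 4 := by rw [Finset.prod_const, Finset.card_univ, Fintype.card_fin]
    exact mul_le_mul_of_nonneg_right hprod (abs_nonneg _)
  -- the right-hand side is non-negative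
  have h30 : (0 : ℝ) ≤ cW * (2 * n : ℝ) ^ 4 := by positivity
  have hRHS0 : 0 ≤ cW * (2 * n : ℝ) ^ 4 * M ^ 4 *
      ((∑ u ∈ Fintype.piFinset (fun _ : Fin 4 => latticeBox d (r * L)), |U u|) / blockSpinVariance μ L ^ 2) *
      (γ * (∫ σ, normalizedField μ L (fun x => |f x|) σ ^ 2 ∂μ) ^ (n - 2)) :=
    mul_nonneg (mul_nonneg (mul_nonneg h30 (pow_nonneg hM0 4)) hS0)
      (mul_nonneg hγ0 (pow_nonneg hmom2_0 _))
  -- Step 1: the deviation identity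
  rw [integral_normalizedField_pow_sub_wick μ hLne hfr n, ← hc, ← hΛ]
  -- Step 2: absolute values inside, the pointwise bound, factorisation along each 4-subset
  have hmem : ∀ p ∈ Fintype.piFinset (fun _ : Fin (2 * n) => Λ), ∀ i, p i ∈ latticeBox d (r * L) := by
    intro p hp i
    rw [← hbox]
    exact Fintype.mem_piFinset.mp hp i
  have hR : ∀ p : Fin (2 * n) → Site d, wickRemainder S₂ U n p =
      ∑ s : {s : Finset (Fin (2 * n)) // s.card = 4}, |U (restrictFour p s)| * P (removeFour p s) :=
    fun p => rfl
  have hsum : |∑ p ∈ Fintype.piFinset (fun _ : Fin (2 * n) => Λ),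
      (∏ i, g (p i)) * (nPoint μ spinAt p - G p)| ≤
      cW * ((Fintype.card {s : Finset (Fin (2 * n)) // s.card = 4} : ℝ) * (A * B)) := by
    calc |∑ p ∈ Fintype.piFinset (fun _ : Fin (2 * n) => Λ),
          (∏ i, g (p i)) * (nPoint μ spinAt p - G p)|
        ≤ ∑ p ∈ Fintype.piFinset (fun _ : Fin (2 * n) => Λ),
            (∏ i, |g (p i)|) * |nPoint μ spinAt p - G p| := by
          refine (Finset.abs_sum_le_sum_abs _ _).trans (le_of_eq (Finset.sum_congr rfl fun p _ => ?_))
          rw [abs_mul, Finset.abs_prod]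
      _ ≤ ∑ p ∈ Fintype.piFinset (fun _ : Fin (2 * n) => Λ),
            (∏ i, |g (p i)|) * (cW * ∑ s : {s : Finset (Fin (2 * n)) // s.card = 4},
              |U (restrictFour p s)| * P (removeFour p s)) :=
          Finset.sum_le_sum fun p hp => mul_le_mul_of_nonneg_left
            (by rw [← hR p]; exact hW n hn p (hmem p hp))
            (Finset.prod_nonneg fun i _ => abs_nonneg _)
      _ = cW * ∑ s : {s : Finset (Fin (2 * n)) // s.card = 4},
            ∑ p ∈ Fintype.piFinset (fun _ : Fin (2 * n) => Λ),
              (∏ i, |g (p i)|) * (P (removeFour p s) * |U (restrictFour p s)|) := by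
          rw [Finset.sum_comm, Finset.mul_sum]
          refine Finset.sum_congr rfl fun p _ => ?_
          rw [Finset.mul_sum, Finset.mul_sum, Finset.mul_sum]
          refine Finset.sum_congr rfl fun s _ => ?_
          ring
      _ = cW * ∑ _s : {s : Finset (Fin (2 * n)) // s.card = 4}, A * B := by
          congr 1
          refine Finset.sum_congr rfl fun s _ => ?_
          rw [sum_prod_mul_removeFour_mul_restrictFour Λ (fun a => |g a|) P (fun u => |U u|) s]
      _ = cW * ((Fintype.card {s : Finset (Fin (2 * n)) // s.card = 4} : ℝ) * (A * B)) := by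
          rw [Finset.sum_const, Finset.card_univ, nsmul_eq_mul]
  -- Step 3: the case `Σ_L = 0` (then `c = 0`)
  rcases hSig0.eq_or_lt with hSig | hSig
  · have hc' : c = 0 := by rw [hc, ← hSig, Real.sqrt_zero, inv_zero]
    rw [hc', zero_pow (by omega), zero_mul, abs_zero]
    exact hRHS0
  -- Step 4: `Σ_L > 0`: normalise by `c^{2n} = (c²)^{n-2} c⁴`, `c⁴ = Σ_L⁻²`
  have hcpos : 0 < c := inv_pos.mpr (Real.sqrt_pos.mpr hSig)
  have hc4 : c ^ 4 = (blockSpinVariance μ L ^ 2)⁻¹ := by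
    rw [hc, inv_pow, show (4 : ℕ) = 2 * 2 from rfl, pow_mul, Real.sq_sqrt hSig0]
  have hV₂0 : 0 ≤ V₂ := by
    have h := hmom2_0
    rw [hmom2] at h
    exact (mul_nonneg_iff_of_pos_left (pow_pos hcpos 2)).mp h
  have hA0 : 0 ≤ A := by rw [hAeq]; exact mul_nonneg hγ0 (pow_nonneg hV₂0 _)
  have hcA0 : 0 ≤ (c ^ 2) ^ (n - 2) * A := mul_nonneg (pow_nonneg (pow_nonneg hc0 2) _) hA0
  have hcard := (card_fourSubsets_le (n := n))
  have hcsplit : c ^ (2 * n) = (c ^ 2) ^ (n - 2) * c ^ 4 := by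
    rw [← pow_mul, ← pow_add]; congr 1; omega
  rw [abs_mul, abs_of_nonneg (pow_nonneg hc0 _), hcsplit]
  calc (c ^ 2) ^ (n - 2) * c ^ 4 * |∑ p ∈ Fintype.piFinset (fun _ : Fin (2 * n) => Λ),
        (∏ i, g (p i)) * (nPoint μ spinAt p - G p)|
      ≤ (c ^ 2) ^ (n - 2) * c ^ 4 *
          (cW * ((Fintype.card {s : Finset (Fin (2 * n)) // s.card = 4} : ℝ) * (A * B))) :=
        mul_le_mul_of_nonneg_left hsum (mul_nonneg (pow_nonneg (pow_nonneg hc0 2) _) (pow_nonneg hc0 4))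
    _ = cW * (Fintype.card {s : Finset (Fin (2 * n)) // s.card = 4} : ℝ) *
          ((c ^ 2) ^ (n - 2) * A) * (c ^ 4 * B) := by ring
    _ ≤ cW * (2 * n : ℝ) ^ 4 * ((c ^ 2) ^ (n - 2) * A) * (c ^ 4 * (M ^ 4 * Us)) :=
        mul_le_mul (mul_le_mul_of_nonneg_right (mul_le_mul_of_nonneg_left hcard hcW) hcA0)
          (mul_le_mul_of_nonneg_left hBle (pow_nonneg hc0 4))
          (mul_nonneg (pow_nonneg hc0 4) hB0) (mul_nonneg h30 hcA0)
    _ = cW * (2 * n : ℝ) ^ 4 * M ^ 4 *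
          ((∑ u ∈ Fintype.piFinset (fun _ : Fin 4 => latticeBox d (r * L)), |U u|) / blockSpinVariance μ L ^ 2) *
          (γ * (∫ σ, normalizedField μ L (fun x => |f x|) σ ^ 2 ∂μ) ^ (n - 2)) := by
        rw [hmom2, hS, hc4, hAeq, div_eq_mul_inv, mul_pow]
        ring

end Smearing

end Literature.Probability.LatticeModels

end
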